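import Summits.QuantumAdvantage.QuantumAdvantage.Theorems.LinnikCubicClassGroupsDegreeOnePrimesEscapeChebotarevDivisionSplittingType
import Summits.QuantumAdvantage.QuantumAdvantage.Theorems.LinnikCubicClassGroupsDegreeOnePrimesEscapeSymmetricClosure
import Mathlib.GroupTheory.Perm.Cycle.PossibleTypes
import HarnessLib

/-!
# Every partition of `n` is the splitting type of a prime `p ≤ |d_K|^{L(n)}` in an `S_n`-field of degree `n`

Topic `Summits/QuantumAdvantage/QuantumAdvantage/Theorems`, cell B2b-1 (linnik-cubic), PART A (gen 10);
helper toward the crux `DegreeOnePrimesEscape` (stmt-QuantumAdvantage-11543) of route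
`LinnikCubicClassGroups`.  HONEST FRAMING: the value of this file is a THEOREM (kernel-checked, GRH-free,
Siegel-free, no hypothesis) — NOT summit progress.

**Theorem** (`exists_prime_splittingType_eq_of_symmetric`).  For `n > 1` there is `L = L(n) > 0` such
that for every number field `K` of degree `n` all of whose Galois splitting fields have degree `≥ n!` (the
generic "`S_n`-field") and EVERY multiset `T` of positive integers with `Σ T = n` (every partition of `n`)
there is a prime `p ≤ |d_K|^L`, `p ∤ d_K`, whose splitting type in `K` is exactly `T`:
`splittingType K p = T`.  (Lagarias–Montgomery–Odlyzko's least prime in a conjugacy class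
[LagariasMontgomeryOdlyzko1979, Thm 1.1] for `S_n`, where every class is a division, read through Dedekind's
cycle-type dictionary; inexplicit `L`.)

Ingredients: the Chebotarev–Linnik theorem for divisions in splitting form (`exists_prime_splitting_as_le`,
gen 9), the embedded `S_n`-closure (`symmetricClosure`, gen 8) with its stabiliser bookkeeping, and the
combinatorial identity `card_fixedPoints_pow_add` proved here: for `τ ∈ Perm α`,
`#Fix(τ^m) + #supp τ = |α| + Σ_{c ∈ cycleType τ, c ∣ m} c`, so that the sums `Σ_{f ∈ T, f ∣ m} f` of the
"full cycle type" `T = cycleType τ + (fixed points) · {1}` are the fixed-point counts of the powers of `τ`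
(`sum_filter_dvd_fullCycleType`), which determine `T` (`eq_of_forall_sum_filter_dvd_eq`, tree); every partition
of `n` is a full cycle type (`exists_fullCycleType_eq`, from Mathlib's `Equiv.Perm.exists_with_cycleType_iff`).
-/

noncomputable section

open scoped NumberField nonZeroDivisors
open Finset Real Ideal NumberField
open Literature.NumberTheory.NumberFields Literature.NumberTheory.LFunctions
  Literature.NumberTheory.LFunctions.NumberField

namespace Summit.QuantumAdvantage.QuantumAdvantage.Theorems.DegreeOnePrimesEscape

/-! ### Fixed points of the powers of a permutation -/

section Perm

variable {α : Type*} [Fintype α] [DecidableEq α]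

/-- **Fixed points of powers**: `#{x : τ^m x = x} + #supp τ = |α| + Σ_{c ∈ cycleType τ, c ∣ m} c`. -/
theorem card_fixedPoints_pow_add (τ : Equiv.Perm α) (m : ℕ) :
    (Finset.univ.filter fun x : α => (τ ^ m) x = x).card + τ.support.card =
      Fintype.card α + ((τ.cycleType.filter (· ∣ m)).sum) := by
  classical
  induction τ using Equiv.Perm.cycle_induction_on with
  | base_one =>
    simp [Equiv.Perm.cycleType_one, Equiv.Perm.support_one]
  | base_cycles σ hσ =>
    set k : ℕ := σ.support.card with hk
    -- outside the support every point is fixed; inside, all or none according to `k ∣ m`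
    have hsplit : (Finset.univ.filter fun x : α => (σ ^ m) x = x) =
        (σ.support.filter fun x : α => (σ ^ m) x = x) ∪ σ.supportᶜ := by
      ext x
      simp only [Finset.mem_filter, Finset.mem_univ, true_and, Finset.mem_union, Finset.mem_compl,
        Equiv.Perm.mem_support, not_not]
      constructor
      · intro h
        by_cases hx : σ x = x
        · exact Or.inr hx
        · exact Or.inl ⟨hx, h⟩
      · rintro (⟨-, h⟩ | h)
        · exact h
        · exact Equiv.Perm.pow_apply_eq_self_of_apply_eq_self h m
    have hdisj : Disjoint (σ.support.filter fun x : α => (σ ^ m) x = x) σ.supportᶜ :=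
      Finset.disjoint_of_subset_left (Finset.filter_subset _ _) disjoint_compl_right
    have hin : (σ.support.filter fun x : α => (σ ^ m) x = x).card = if k ∣ m then k else 0 := by
      have hiff : ∀ x ∈ σ.support, ((σ ^ m) x = x ↔ k ∣ m) := by
        intro x hx
        rw [Equiv.Perm.mem_support] at hx
        rw [← hσ.pow_eq_one_iff' (n := m) hx, ← orderOf_dvd_iff_pow_eq_one, hσ.orderOf]
      split_ifs with hkm
      · rw [Finset.filter_true_of_mem fun x hx => (hiff x hx).mpr hkm]
      · rw [Finset.filter_false_of_mem fun x hx => fun h => hkm ((hiff x hx).mp h), Finset.card_empty]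
    rw [hsplit, Finset.card_union_of_disjoint hdisj, hin, Finset.card_compl, hσ.cycleType]
    simp only [Multiset.filter_singleton]
    have hkle : k ≤ Fintype.card α := Finset.card_le_univ _
    split_ifs <;> simp <;> omega
  | induction_disjoint σ τ hστ _ hPσ hPτ =>
    have hcomm : Commute σ τ := hστ.commute
    have hpow : (σ * τ) ^ m = σ ^ m * τ ^ m := hcomm.mul_pow m
    have hdm : Equiv.Perm.Disjoint (σ ^ m) (τ ^ m) := hστ.pow_disjoint_pow m m
    have hfilt : (Finset.univ.filter fun x : α => ((σ * τ) ^ m) x = x) =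
        (Finset.univ.filter fun x : α => (σ ^ m) x = x) ∩ (Finset.univ.filter fun x : α => (τ ^ m) x = x) := by
      ext x
      simp only [Finset.mem_filter, Finset.mem_univ, true_and, Finset.mem_inter, hpow]
      exact hdm.mul_apply_eq_iff
    have hunion : (Finset.univ.filter fun x : α => (σ ^ m) x = x) ∪
        (Finset.univ.filter fun x : α => (τ ^ m) x = x) = Finset.univ := by
      ext x
      simp only [Finset.mem_union, Finset.mem_filter, Finset.mem_univ, true_and, iff_true]
      exact hdm x
    have hcard := Finset.card_union_add_card_inter (Finset.univ.filter fun x : α => (σ ^ m) x = x)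
      (Finset.univ.filter fun x : α => (τ ^ m) x = x)
    rw [hunion, ← hfilt, Finset.card_univ] at hcard
    rw [hστ.card_support_mul, hστ.cycleType_mul, Multiset.filter_add, Multiset.sum_add]
    omega

/-- **The full cycle type and the fixed points of powers**: with `T = cycleType τ + (|α| − #supp τ) · {1}`,
`Σ_{f ∈ T, f ∣ m} f = #{x : τ^m x = x}` for every `m`. -/
theorem sum_filter_dvd_fullCycleType (τ : Equiv.Perm α) (m : ℕ) :
    ((τ.cycleType + Multiset.replicate (Fintype.card α - τ.support.card) 1).filter (· ∣ m)).sum =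
      (Finset.univ.filter fun x : α => (τ ^ m) x = x).card := by
  have h := card_fixedPoints_pow_add τ m
  have hle : τ.support.card ≤ Fintype.card α := Finset.card_le_univ _
  have hrep : (Multiset.replicate (Fintype.card α - τ.support.card) 1).filter (· ∣ m) =
      Multiset.replicate (Fintype.card α - τ.support.card) 1 :=
    Multiset.filter_eq_self.mpr (fun a ha => by rw [Multiset.eq_of_mem_replicate ha]; exact one_dvd m)
  rw [Multiset.filter_add, Multiset.sum_add, hrep, Multiset.sum_replicate, smul_eq_mul, mul_one]
  omega

/-- The entries of a full cycle type are positive. -/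
theorem pos_of_mem_fullCycleType (τ : Equiv.Perm α) {f : ℕ}
    (hf : f ∈ τ.cycleType + Multiset.replicate (Fintype.card α - τ.support.card) 1) : 0 < f := by
  rcases Multiset.mem_add.mp hf with h | h
  · exact lt_of_lt_of_le (by norm_num) (Equiv.Perm.two_le_of_mem_cycleType h)
  · rw [Multiset.eq_of_mem_replicate h]; exact one_pos

/-- **Every partition of `|α|` is a full cycle type**: for a multiset `T` of positive integers with
`Σ T = |α|` there is `τ ∈ Perm α` with `cycleType τ + (|α| − #supp τ) · {1} = T`. -/
theorem exists_fullCycleType_eq (T : Multiset ℕ) (hT : T.sum = Fintype.card α) (hpos : ∀ f ∈ T, 0 < f) :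
    ∃ τ : Equiv.Perm α, τ.cycleType + Multiset.replicate (Fintype.card α - τ.support.card) 1 = T := by
  classical
  set T₂ : Multiset ℕ := T.filter (2 ≤ ·) with hT₂
  set T₁ : Multiset ℕ := T.filter (fun f => ¬ 2 ≤ f) with hT₁
  have hsplit : T₂ + T₁ = T := Multiset.filter_add_not _ T
  have hsum : T₂.sum + T₁.sum = Fintype.card α := by rw [← Multiset.sum_add, hsplit, hT]
  have hT₁ : T₁ = Multiset.replicate (Multiset.card T₁) 1 :=
    Multiset.eq_replicate.mpr ⟨rfl, fun b hb => by
      rw [hT₁, Multiset.mem_filter] at hb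
      have := hpos b hb.1
      omega⟩
  have hT₁sum : T₁.sum = Multiset.card T₁ := by
    conv_lhs => rw [hT₁]
    rw [Multiset.sum_replicate, smul_eq_mul, mul_one]
  obtain ⟨τ, hτ⟩ := (Equiv.Perm.exists_with_cycleType_iff α).mpr
    ⟨show T₂.sum ≤ Fintype.card α by omega, fun a ha => (Multiset.mem_filter.mp ha).2⟩
  refine ⟨τ, ?_⟩
  have hsupp : τ.support.card = T₂.sum := by rw [← Equiv.Perm.sum_cycleType, hτ]
  rw [hτ, hsupp]
  conv_rhs => rw [← hsplit, hT₁]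
  rw [show Fintype.card α - T₂.sum = Multiset.card T₁ by omega]

end Perm

/-! ### The theorem -/

set_option maxHeartbeats 800000 in
/-- **Every partition of `n` is a splitting type below `|d_K|^{L(n)}` in an `S_n`-field of degree `n`.**
For `n > 1` there is `L > 0` such that for every number field `K` of degree `n` all of whose Galois
splitting fields have degree `≥ n!`, and every multiset `T` of positive integers with `Σ T = n`, there is a
prime `p ≤ |d_K|^L`, `p ∤ d_K`, with `splittingType K p = T`.  Unconditional.
[cite: LagariasMontgomeryOdlyzko1979, Theorem 1.1] [cite: Perlis1977, §1] -/
theorem exists_prime_splittingType_eq_of_symmetric (n : ℕ) [NeZero n] (hn : 1 < n) :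
    ∃ L : ℝ, 0 < L ∧ ∀ (K : Type) [Field K] [NumberField K], Module.finrank ℚ K = n →
      (∀ (M : Type) [Field M] [NumberField M] [IsGalois ℚ M],
        (K →ₐ[ℚ] M) → n.factorial ≤ Module.finrank ℚ M) →
      ∀ T : Multiset ℕ, T.sum = n → (∀ f ∈ T, 0 < f) →
        ∃ p : ℕ, p.Prime ∧ (p : ℝ) ≤ ((NumberField.discr K).natAbs : ℝ) ^ L ∧
          ¬ ((p : ℤ) ∣ NumberField.discr K) ∧ splittingType K p = T := by
  classical
  have hnf : 1 < n.factorial := lt_of_lt_of_le hn (Nat.self_le_factorial n)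
  obtain ⟨L₀, hL₀, hgen⟩ := exists_prime_splitting_as_le n.factorial hnf
  refine ⟨n.factorial * L₀, by positivity, fun K _ _ hK hSn T hTsum hTpos => ?_⟩
  obtain ⟨N, _, _, hGal, hdeg, K', e, ψ, hstab, hdN⟩ := symmetricClosure n K hK hSn
  haveI := hGal
  -- a permutation with full cycle type `T`
  have hcardFin : Fintype.card (Fin n) = n := Fintype.card_fin n
  obtain ⟨τ, hτ⟩ := exists_fullCycleType_eq (α := Fin n) T (by rw [hcardFin]; exact hTsum) hTpos
  -- the prime with the splitting behaviour of `σ = ψ⁻¹ τ`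
  obtain ⟨p, hp, hpx, hpN, hall⟩ := hgen N hdeg (ψ.symm τ)
  -- sizes
  set d : ℝ := ((NumberField.discr K).natAbs : ℝ) with hd
  have hd3 : (3 : ℝ) ≤ d := three_le_natAbs_discr_real K (by rw [hK]; exact hn)
  have hd1 : (1 : ℝ) ≤ d := by linarith
  have hpx' : (p : ℝ) ≤ d ^ ((n.factorial : ℝ) * L₀) := by
    have hdNR : ((NumberField.discr N).natAbs : ℝ) ≤ d ^ (n.factorial : ℝ) := by
      rw [Real.rpow_natCast, hd]; exact_mod_cast hdN
    calc (p : ℝ) ≤ ((NumberField.discr N).natAbs : ℝ) ^ L₀ := hpx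
      _ ≤ (d ^ (n.factorial : ℝ)) ^ L₀ := Real.rpow_le_rpow (Nat.cast_nonneg _) hdNR hL₀.le
      _ = d ^ ((n.factorial : ℝ) * L₀) := by rw [← Real.rpow_mul (by linarith)]
  have hdisc' : NumberField.discr K' = NumberField.discr K :=
    (NumberField.discr_eq_discr_of_algEquiv K e).symm
  have hdvd : ¬ ((p : ℤ) ∣ NumberField.discr K) := fun h =>
    hpN (h.trans (hdisc' ▸ NumberField.discr_dvd_discr K' N))
  refine ⟨p, hp, by exact_mod_cast hpx', hdvd, ?_⟩
  -- the sums `Σ_{f ∣ j} f` of `T_K(p)` are the fixed-point counts of `τ^j`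
  have hA : 0 < (Finset.univ.filter fun q : Equiv.Perm (Fin n) => q 0 = 0).card :=
    Finset.card_pos.mpr ⟨1, Finset.mem_filter.mpr ⟨Finset.mem_univ _, rfl⟩⟩
  have hsums : ∀ j : ℕ, ((splittingType K p).filter (· ∣ j)).sum =
      ((τ.cycleType + Multiset.replicate (Fintype.card (Fin n) - τ.support.card) 1).filter (· ∣ j)).sum := by
    intro j
    have hk := hall K' j
    rw [natCard_subgroup_eq_card_filter_perm ψ K'.fixingSubgroup (fun q => q 0 = 0) hstab,
      natCard_conj_mem_eq_card_filter_perm ψ K'.fixingSubgroup (fun q => q 0 = 0) hstab, map_pow,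
      MulEquiv.apply_symm_apply, card_filter_conj_apply_zero,
      ← ArithmeticallyEquivalent.of_algEquiv e p hp] at hk
    rw [sum_filter_dvd_fullCycleType, ← Nat.eq_of_mul_eq_mul_left hA hk]
  rw [← hτ]
  exact eq_of_forall_sum_filter_dvd_eq _ _ _ rfl (fun f hf => splittingType_pos hp hf)
    (fun f hf => pos_of_mem_fullCycleType τ hf) hsums

end Summit.QuantumAdvantage.QuantumAdvantage.Theorems.DegreeOnePrimesEscape

end
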